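import Summits.Ventures.Crystal3D.Bulk.GapEquivalence
import HarnessLib

/-!
# HOLE ⇔ GAP: the spherical ("angular") form of the twelve-neighbour gap

HONEST FRAMING. Part of the venture `Summits/Ventures/Crystal3D` (cell `pub-crystal3d`, phase 2,
PLAN R42.3; the 24-hour sprint's `TARGET-GAP.md` §3). The cell's engines certify the gap
`GAP(h*)`, `h* = 1.26`, in its ANGULAR FORM (AG): "there is NO `(x₁, …, x₁₂, p) ∈ (S²)¹³` with
`⟪xᵢ, xⱼ⟫ ≤ 1/2` for all `i ≠ j` (shell directions pairwise `≥ 60°`) and `⟪p, xᵢ⟫ ≤ 0.63` for all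
`i` (a hole of angular radius `≥ φ* = arccos 0.63` in the shell)". This file TYPES that statement,
`NoHole t` (parameter `t` = the cosine threshold, `t = h/2`), and PROVES the 3D-to-spherical
reduction both ways:

* `gapTupleDiam_of_noHole : NoHole (h / 2) → GapTupleDiam h` — the direction the sprint uses
  (no side condition): a fourteenth ball at distance `D < h` from a twelve-kissed ball is a
  direction `p` with `⟪p, xᵢ⟫ ≤ D/2 < h/2` for all twelve shell directions `xᵢ`;
* `noHole_of_gapTupleDiam : 1 < h → GapTupleDiam h → ∀ t < h/2, NoHole t` — conversely a hole
  `(x, p)` at level `t < h/2` IS a fourteen-ball configuration `0, x₁, …, x₁₂, max(2t, 1) · p`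
  violating the gap;
* `gapTupleDiam_iff_noHole : 1 < h → (GapTupleDiam h ↔ ∀ t < h/2, NoHole t)` (exact; (AG) at the
  endpoint `t = h/2` itself is a hair stronger than `GAP(h)`, which allows a fourteenth ball AT
  distance `h`), `twelveNeighbourGap_iff_hole` (the labelled form, via `Bulk/GapEquivalence.lean`),
  `NoHole.anti`;
* the sprint's glue with the certified statement LITERALLY the hypothesis:
  `twelveNeighbourGap_of_noHole : NoHole (h/2) → TwelveNeighbourGap h` and
  `bulkCrystallization3D_of_noHole_of_classification :
     NoHole 0.63 → Hales2012_kissingConfigCongruent → BulkCrystallization3D 1296`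
  (standard axioms; the classification hypothesis is the tree's computational theorem
  `Hales2012_kissingConfigCongruent_holds` — discharged in the computational companion file).

Nothing is claimed: `NoHole 0.63` is the object the engines must certify (two implementations,
`TARGET-GAP.md` §4), typed here as its formal referent. Elementary real inner-product algebra only.
-/

noncomputable section

open scoped BigOperators InnerProductSpace
open Finset

namespace Summit.Ventures.Crystal3D

open Literature.Geometry.DiscreteGeometry

/-! ## The angular statement -/

/-- **No hole at cosine level `t`** (the sprint's (AG), `TARGET-GAP.md` §3, with `0.63` replaced by
the parameter `t`): for every twelve unit vectors `x₁, …, x₁₂` with pairwise inner products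
`≤ 1/2` (directions of twelve balls kissing a unit-diameter ball: pairwise angle `≥ 60°`) and every
unit vector `p`, SOME `xᵢ` has `⟪p, xᵢ⟫ > t` — i.e. there is no `(x, p) ∈ (S²)¹³` with
`⟪xᵢ, xⱼ⟫ ≤ 1/2 (i ≠ j)` and `⟪p, xᵢ⟫ ≤ t ∀ i` (no empty spherical cap of angular radius
`arccos t` in the shell). The labels need not be distinct points (coincident `xᵢ = xⱼ` violate
`⟪xᵢ, xⱼ⟫ ≤ 1/2` anyway). `NoHole 0.63` is GAP(1.26) in angular form (`gapTupleDiam_of_noHole`). -/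
def NoHole (t : ℝ) : Prop :=
  ∀ (x : Fin 12 → EuclideanSpace ℝ (Fin 3)) (p : EuclideanSpace ℝ (Fin 3)),
    (∀ i, ‖x i‖ = 1) → ‖p‖ = 1 → (∀ i j, i ≠ j → ⟪x i, x j⟫_ℝ ≤ 1 / 2) →
      ∃ i, t < ⟪p, x i⟫_ℝ

/-- A lower cosine level is a weaker statement: `NoHole` is antitone in `t`. -/
theorem NoHole.anti {t t' : ℝ} (h : t' ≤ t) (ht : NoHole t) : NoHole t' :=
  fun x p hx hp hxx => (ht x p hx hp hxx).imp fun _ hi => lt_of_le_of_lt h hi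

/-! ## Inner products versus distances for unit vectors -/

/-- For unit vectors, `dist u v ≥ 1 ↔ ⟪u, v⟫ ≤ 1/2` (`‖u - v‖² = 2 - 2⟪u, v⟫`). -/
theorem one_le_dist_iff_inner_le_half {u v : EuclideanSpace ℝ (Fin 3)} (hu : ‖u‖ = 1)
    (hv : ‖v‖ = 1) : 1 ≤ dist u v ↔ ⟪u, v⟫_ℝ ≤ 1 / 2 := by
  have hsq : dist u v ^ 2 = 2 - 2 * ⟪u, v⟫_ℝ := by
    rw [dist_eq_norm, norm_sub_sq_real, hu, hv]; ring
  constructor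
  · intro h
    nlinarith [h, hsq]
  · intro h
    have h2 : (1 : ℝ) ≤ dist u v ^ 2 := by rw [hsq]; linarith
    nlinarith [dist_nonneg (x := u) (y := v), h2]

/-- For a unit vector `v`, a scalar `D > 0` and a unit vector `p`:
`dist (D • p) v ≥ 1 ↔ ⟪p, v⟫ ≤ D/2` (`‖D p - v‖² = D² - 2D⟪p, v⟫ + 1`). -/
theorem one_le_dist_smul_iff {p v : EuclideanSpace ℝ (Fin 3)} (hp : ‖p‖ = 1) (hv : ‖v‖ = 1)
    {D : ℝ} (hD : 0 < D) : 1 ≤ dist (D • p) v ↔ ⟪p, v⟫_ℝ ≤ D / 2 := by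
  have hsq : dist (D • p) v ^ 2 = D ^ 2 - 2 * D * ⟪p, v⟫_ℝ + 1 := by
    rw [dist_eq_norm, norm_sub_sq_real, norm_smul, Real.norm_of_nonneg hD.le, hp, hv,
      real_inner_smul_left]
    ring
  constructor
  · intro h
    have h1 : (1 : ℝ) ≤ dist (D • p) v ^ 2 := by nlinarith [h]
    rw [hsq] at h1
    have : 2 * D * ⟪p, v⟫_ℝ ≤ D ^ 2 := by linarith
    rw [le_div_iff₀ (by norm_num : (0 : ℝ) < 2)]
    nlinarith [this, hD]
  · intro h
    have h1 : (1 : ℝ) ≤ dist (D • p) v ^ 2 := by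
      rw [hsq]
      have : 2 * D * ⟪p, v⟫_ℝ ≤ D ^ 2 := by
        rw [le_div_iff₀ (by norm_num : (0 : ℝ) < 2)] at h
        nlinarith [h, hD]
      linarith
    nlinarith [dist_nonneg (x := D • p) (y := v), h1]

/-- **Distance form of `NoHole`** — literally the shape of the cell's `ShellCapFree` (idea-2's
Tammes-bridge sketch: "twelve unit vectors pairwise at distance `≥ 1` and a unit vector `z` with
all `⟪xᵢ, z⟫ ≤ t` is impossible"): for unit vectors `dist ≥ 1 ↔ ⟪·,·⟫ ≤ 1/2`, and
`(∃ i, t < ⟪p, xᵢ⟫) ↔ ¬ ∀ i, ⟪xᵢ, p⟫ ≤ t`. So the bridge `musinTarasov2012_tammes_thirteen → …` may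
conclude either form. -/
theorem noHole_iff_capFree (t : ℝ) : NoHole t ↔
    ∀ (x : Fin 12 → EuclideanSpace ℝ (Fin 3)) (z : EuclideanSpace ℝ (Fin 3)), ‖z‖ = 1 →
      (∀ i, ‖x i‖ = 1) → (∀ i j, i ≠ j → (1 : ℝ) ≤ dist (x i) (x j)) →
        (∀ i, ⟪x i, z⟫_ℝ ≤ t) → False := by
  constructor
  · intro h x z hz hx hd hcap
    obtain ⟨i, hi⟩ := h x z hx hz fun i j hij =>
      (one_le_dist_iff_inner_le_half (hx i) (hx j)).1 (hd i j hij)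
    rw [real_inner_comm] at hi
    exact absurd (hcap i) (not_le.2 hi)
  · intro h x p hx hp hxx
    by_contra hall
    push Not at hall
    exact h x p hp hx (fun i j hij => (one_le_dist_iff_inner_le_half (hx i) (hx j)).2 (hxx i j hij))
      fun i => by rw [real_inner_comm]; exact hall i

/-! ## (AG) ⇒ GAP: the direction the sprint uses -/

/-- The labels `1, …, 12` of `Fin 14`, indexed by `Fin 12`. -/
private def midIdx (k : Fin 12) : Fin 14 := ⟨k.val + 1, by omega⟩

/-- A shell label is not the centre label `0`. -/
private theorem midIdx_ne_zero (k : Fin 12) : midIdx k ≠ 0 := by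
  intro h
  have := congrArg Fin.val h
  simp [midIdx] at this

/-- A shell label is not the far label `13`. -/
private theorem midIdx_ne_thirteen (k : Fin 12) : midIdx k ≠ 13 := by
  intro h
  have := congrArg Fin.val h
  simp [midIdx] at this
  omega

/-- Distinct shell indices give distinct labels. -/
private theorem midIdx_injective : Function.Injective midIdx := by
  intro k l h
  have := congrArg Fin.val h
  simp [midIdx] at this
  exact Fin.ext this

/-- **(AG) ⇒ GAP(h)**: `NoHole (h/2)` implies the fourteen-ball gap `GapTupleDiam h`. Given the
fourteen centres, the twelve shell directions `vₖ = c_{k+1} - c₀` are unit vectors with pairwise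
inner products `≤ 1/2`; if `D = dist c₀ c₁₃ < h`, the direction `p = (c₁₃ - c₀)/D` has
`⟪p, vₖ⟫ ≤ D/2 < h/2` for every `k` (because `dist c₁₃ c_{k+1} ≥ 1`), contradicting `NoHole (h/2)`.
-/
theorem gapTupleDiam_of_noHole {h : ℝ} (hAG : NoHole (h / 2)) : GapTupleDiam h := by
  intro c hpack htouch
  by_contra hlt
  push Not at hlt
  -- the twelve shell directions
  set v : Fin 12 → EuclideanSpace ℝ (Fin 3) := fun k => c (midIdx k) - c 0 with hv
  have hv1 : ∀ k, ‖v k‖ = 1 := fun k => by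
    rw [hv, ← dist_eq_norm]; exact htouch _ (midIdx_ne_zero k) (midIdx_ne_thirteen k)
  have hvv : ∀ k l, k ≠ l → ⟪v k, v l⟫_ℝ ≤ 1 / 2 := by
    intro k l hkl
    rw [← one_le_dist_iff_inner_le_half (hv1 k) (hv1 l)]
    have : dist (v k) (v l) = dist (c (midIdx k)) (c (midIdx l)) := by
      rw [hv]; simp [dist_eq_norm]
    rw [this]
    exact hpack _ _ fun h' => hkl (midIdx_injective h')
  -- the fourteenth direction
  set D : ℝ := dist (c 0) (c 13) with hD
  have hD1 : 1 ≤ D := hpack 0 13 (by decide)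
  have hDpos : 0 < D := by linarith
  set p : EuclideanSpace ℝ (Fin 3) := D⁻¹ • (c 13 - c 0) with hp
  have hnorm : ‖c 13 - c 0‖ = D := by rw [← dist_eq_norm, dist_comm]
  have hp1 : ‖p‖ = 1 := by
    rw [hp, norm_smul, norm_inv, Real.norm_of_nonneg hDpos.le, hnorm, inv_mul_cancel₀ hDpos.ne']
  have hDp : D • p = c 13 - c 0 := by
    rw [hp, smul_smul, mul_inv_cancel₀ hDpos.ne', one_smul]
  have hpv : ∀ k, ⟪p, v k⟫_ℝ ≤ D / 2 := by
    intro k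
    rw [← one_le_dist_smul_iff hp1 (hv1 k) hDpos, hDp]
    have : dist (c 13 - c 0) (v k) = dist (c 13) (c (midIdx k)) := by
      rw [hv]; simp [dist_eq_norm]
    rw [this]
    exact hpack _ _ (by intro h'; exact midIdx_ne_thirteen k h'.symm)
  obtain ⟨k, hk⟩ := hAG v p hv1 hp1 hvv
  have := hpv k
  linarith

/-- **(AG) ⇒ GAP, radius-one fourteen-ball form** (the cell's `CapReduction κ`, discharged):
`NoHole κ → GapTuple (4κ)` (Hales's normalisation: touching centres at distance `2`; at `κ = 0.63`
this is `GapTuple 2.52`). -/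
theorem gapTuple_of_noHole {κ : ℝ} (hAG : NoHole κ) : GapTuple (4 * κ) := by
  have h : GapTupleDiam (2 * κ) :=
    gapTupleDiam_of_noHole (by rw [show 2 * κ / 2 = κ by ring]; exact hAG)
  rw [show 4 * κ = 2 * (2 * κ) by ring]
  exact (gapTupleDiam_iff (2 * κ)).1 h

/-- In particular `NoHole 0.63 → GapTuple 2.52` (TARGET-GAP §3: "(AG) ⇒ GapTuple 2.52"). -/
theorem gapTuple_252_of_noHole (hAG : NoHole 0.63) : GapTuple 2.52 := by
  rw [show (2.52 : ℝ) = 4 * 0.63 by norm_num]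
  exact gapTuple_of_noHole hAG

/-! ## GAP ⇒ (AG) below the endpoint -/

/-- **GAP(h) ⇒ (AG) at every level `t < h/2`** (for `h > 1`): a hole `(x, p)` at level `t` yields
the fourteen-ball configuration `c₀ = 0`, `c_{k+1} = xₖ`, `c₁₃ = max(2t, 1) · p`, pairwise `≥ 1`
apart with `c₁, …, c₁₂` touching `c₀` and `dist c₀ c₁₃ = max(2t, 1) < h`. -/
theorem noHole_of_gapTupleDiam {h : ℝ} (h1 : 1 < h) (hg : GapTupleDiam h) {t : ℝ}
    (ht : t < h / 2) : NoHole t := by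
  intro x p hx hp hxx
  by_contra hall
  push Not at hall
  -- the fourteenth ball at distance `D = max (2t) 1`
  set D : ℝ := max (2 * t) 1 with hD
  have hD1 : 1 ≤ D := le_max_right _ _
  have hDpos : 0 < D := by linarith
  have hDt : ∀ i, ⟪p, x i⟫_ℝ ≤ D / 2 := fun i =>
    (hall i).trans
      (by rw [hD, le_div_iff₀ (by norm_num : (0 : ℝ) < 2), mul_comm]; exact le_max_left _ _)
  have hDh : D < h := max_lt (by linarith) h1
  -- the configuration
  set c : Fin 14 → EuclideanSpace ℝ (Fin 3) := Fin.cons 0 (Fin.snoc x (D • p)) with hc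
  have hc0 : c 0 = 0 := by rw [hc]; rfl
  have hc13 : c 13 = D • p := by
    rw [hc, show (13 : Fin 14) = Fin.succ (Fin.last 12) by rfl, Fin.cons_succ, Fin.snoc_last]
  have hcmid : ∀ k : Fin 12, c (Fin.succ (Fin.castSucc k)) = x k := fun k => by
    rw [hc, Fin.cons_succ, Fin.snoc_castSucc]
  -- distances from the centre
  have hd0x : ∀ k, dist (x k) 0 = 1 := fun k => by rw [dist_zero_right, hx k]
  have hd0p : dist (D • p) 0 = D := by
    rw [dist_zero_right, norm_smul, Real.norm_of_nonneg hDpos.le, hp, mul_one]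
  have hdxx : ∀ k l, k ≠ l → 1 ≤ dist (x k) (x l) := fun k l hkl =>
    (one_le_dist_iff_inner_le_half (hx k) (hx l)).2 (hxx k l hkl)
  have hdpx : ∀ k, 1 ≤ dist (D • p) (x k) := fun k =>
    (one_le_dist_smul_iff hp (hx k) hDpos).2 (hDt k)
  -- every label is the centre, a shell label, or the last one
  have hcases :
      ∀ i : Fin 14, i = 0 ∨ (∃ k : Fin 12, i = Fin.succ (Fin.castSucc k)) ∨ i = 13 := by
    intro i
    rcases Fin.eq_zero_or_eq_succ i with rfl | ⟨i', rfl⟩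
    · exact Or.inl rfl
    · rcases Fin.eq_castSucc_or_eq_last i' with ⟨k, rfl⟩ | rfl
      · exact Or.inr (Or.inl ⟨k, rfl⟩)
      · exact Or.inr (Or.inr rfl)
  have hpack : ∀ i j : Fin 14, i ≠ j → (1 : ℝ) ≤ dist (c i) (c j) := by
    intro i j hij
    rcases hcases i with rfl | ⟨k, rfl⟩ | rfl <;> rcases hcases j with rfl | ⟨l, rfl⟩ | rfl
    · exact absurd rfl hij
    · rw [hc0, hcmid, dist_comm, hd0x]
    · rw [hc0, hc13, dist_comm, hd0p]; exact hD1
    · rw [hcmid, hc0, hd0x]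
    · rw [hcmid, hcmid]
      exact hdxx k l fun hkl => hij (by rw [hkl])
    · rw [hcmid, hc13, dist_comm]; exact hdpx k
    · rw [hc13, hc0, hd0p]; exact hD1
    · rw [hc13, hcmid]; exact hdpx l
    · exact absurd rfl hij
  have htouch : ∀ i : Fin 14, i ≠ 0 → i ≠ 13 → dist (c i) (c 0) = 1 := by
    intro i hi0 hi13
    rcases hcases i with rfl | ⟨k, rfl⟩ | rfl
    · exact absurd rfl hi0
    · rw [hcmid, hc0, hd0x]
    · exact absurd rfl hi13
  have hgap := hg c hpack htouch
  rw [hc0, hc13, dist_comm, hd0p] at hgap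
  linarith

/-! ## The equivalences -/

/-- **HOLE ⇔ GAP, fourteen-ball form** (`h > 1`): `GapTupleDiam h ↔ ∀ t < h/2, NoHole t`. -/
theorem gapTupleDiam_iff_noHole {h : ℝ} (h1 : 1 < h) :
    GapTupleDiam h ↔ ∀ t, t < h / 2 → NoHole t := by
  refine ⟨fun hg t ht => noHole_of_gapTupleDiam h1 hg ht, fun hAG => ?_⟩
  intro c hpack htouch
  by_contra hlt
  push Not at hlt
  -- apply (AG) at the level `t = D/2 < h/2`, `D = dist c₀ c₁₃`, through `GapTupleDiam D'` for
  -- `D' = (D + h)/2`: simpler — use `gapTupleDiam_of_noHole` at the gap `2t` with `D < 2t < h`.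
  set D : ℝ := dist (c 0) (c 13) with hD
  have hmid : NoHole ((D + h) / 2 / 2) := hAG _ (by linarith)
  have hg' : GapTupleDiam ((D + h) / 2) := gapTupleDiam_of_noHole hmid
  have := hg' c hpack htouch
  rw [← hD] at this
  linarith

/-- **HOLE ⇔ GAP, labelled form** (`twelveNeighbourGap_iff_hole`, PLAN R42.3): for `h > 1`, the
twelve-neighbour gap `TwelveNeighbourGap h` of finite packings of unit-diameter balls holds iff the
shell of twelve kissing directions has no hole at any cosine level `t < h/2`. The 3D-to-spherical
dictionary: a fourteenth centre at distance `r` ↦ a direction at angle `≥ arccos (r/2)` from all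
twelve shell directions (monotone in `r`). -/
theorem twelveNeighbourGap_iff_hole {h : ℝ} (h1 : 1 < h) :
    TwelveNeighbourGap h ↔ ∀ t, t < h / 2 → NoHole t := by
  rw [twelveNeighbourGap_iff_gapTupleDiam, gapTupleDiam_iff_noHole h1]

/-! ## The sprint's glue: the certified angular statement as the one hypothesis -/

/-- **(AG) ⇒ the labelled gap**: `NoHole (h/2) → TwelveNeighbourGap h`. -/
theorem twelveNeighbourGap_of_noHole {h : ℝ} (hAG : NoHole (h / 2)) : TwelveNeighbourGap h :=
  twelveNeighbourGap_of_gapTupleDiam (gapTupleDiam_of_noHole hAG)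

/-- **(AG) at `0.63` ⇒ Hales's gap `h₀ = 1.26`** in the labelled form. -/
theorem twelveNeighbourGap_hales_h0_of_noHole (hAG : NoHole 0.63) :
    TwelveNeighbourGap hales_h0 := by
  have h : NoHole (hales_h0 / 2) := by
    rw [hales_h0_eq, show (1.26 : ℝ) / 2 = 0.63 by norm_num]
    exact hAG
  exact twelveNeighbourGap_of_noHole h

/-- **THE SPRINT'S GLUE (standard axioms).** The certified angular statement `NoHole 0.63`
(= GAP(1.26), `TARGET-GAP.md` §3) and the classification of kissing configurations at `2h₀ = 2.52`
(`Hales2012_kissingConfigCongruent`, BIMODAL(1.26) — a computational theorem of the tree,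
`Hales2012_kissingConfigCongruent_holds`) give `L12Local` and bulk crystallization with
`K = 1296`. -/
theorem l12Local_of_noHole_of_classification (hAG : NoHole 0.63)
    (hcl : Hales2012_kissingConfigCongruent) : L12Local :=
  l12Local_of_gap (twelveNeighbourGap_hales_h0_of_noHole hAG) hcl

/-- **THE SPRINT'S GLUE, bulk form (standard axioms)**:
`NoHole 0.63 → Hales2012_kissingConfigCongruent → BulkCrystallization3D 1296`. -/
theorem bulkCrystallization3D_of_noHole_of_classification (hAG : NoHole 0.63)
    (hcl : Hales2012_kissingConfigCongruent) : BulkCrystallization3D 1296 :=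
  bulkCrystallization3D_of_gap (twelveNeighbourGap_hales_h0_of_noHole hAG) hcl

/-! ## The window from above in the angular form -/

/-- **(AG) is FALSE above the Conjecture-H level**: `¬ NoHole t` for every `t > 7√3/18` (the exact
fourteen-ball intruder configuration of `Bulk/IntruderWitness.lean`, a hole of angular radius
`arccos (7√3/18) = 47.656…°`): through `gapTupleDiam_of_noHole` and
`not_gapTupleDiam_of_lt`. So the certificate target `t = 0.63 < 7√3/18 = 0.6735…` sits inside the
window, as `TARGET-GAP.md` §3 records (`ρ* ≥ 47.656387°`). -/
theorem not_noHole_of_lt {t : ℝ} (h : 7 * Real.sqrt 3 / 18 < t) : ¬ NoHole t := by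
  intro hAG
  have hg : GapTupleDiam (2 * t) :=
    gapTupleDiam_of_noHole (by rw [show 2 * t / 2 = t by ring]; exact hAG)
  exact not_gapTupleDiam_of_lt (by linarith) hg

/-- In particular `¬ NoHole 0.6736` (`7√3/18 < 0.6736` since `7√3/9 < 1.3472`), while the sprint's
target is `NoHole 0.63`. -/
theorem not_noHole_6736 : ¬ NoHole 0.6736 :=
  not_noHole_of_lt (by
    have := Intruder.seven_sqrt_three_div_nine_bounds.2
    linarith)

end Summit.Ventures.Crystal3D

end
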